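import Summits.QuantumFields.YangMills.Theorems.BalabanUVNodesN15FullPropagatorV1XTwoSidedNode
import Summits.QuantumFields.YangMills.Theorems.BalabanUVNodesN15BackgroundDressedInverse
import HarnessLib

/-!
# THE NEUMANN INVERSE EXISTS THROUGHOUT THE (3.35)-WINDOW, AND THERE THE EXACTLY DRESSED PROPAGATORS OF FILE 30 ARE THE GREEN's FUNCTIONS OF BAŁABAN's `Δ_a` WITH COVARIANT
# LAPLACIAN — HYPOTHESIS-FREE on the torus family of record (dag-n15-c g10, FILE 32; Track-A node N15 = NE2, s1 «background-layer OPERATOR ingredient»)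

`--kind proof --supports stmt-QuantumFields-20544 --as helper` (K3⁷; count-neutral; theorems only).  Imports BY NAME this seat's FILE 30 `…FullPropagatorV1XTwoSidedNode` (★★ `twoSidedLettersX_torus`,
`v1cfgFX`, `v1cfgCX`; through it FILE 27 ★★ `uniform_layer_fullGM₂R`, `fgInstanceV1G`, FILE 21 `dPiecesM₂`, M1 `hasMaj_unstackM`, n15-b B1a∕B1b `isUnit_stepV`, `hasMaj_stack`, `stack`, `unstackM`,
[B6] `unitTorusGeo`, `rowSum_unitTorusGeo`) and FILE 31 `…BackgroundDressedInverse` (★★★ `covLap_dressed_inverse`); nothing in the tree is modified.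

WHAT.  ★★ `isUnit_neumann_torus_window`: there is `a₀ > 0` (from the (1.110) constant `β` of the `U ≡ 1` layer, the letter scale `κ′` and [B6]'s lattice constant) such that for EVERY index
`i`, every `α₀ > 0` with `Mα₀ ≤ a₀` and every gauge field `A′` regular at `(c₃₅, α₀)` on the fine carrier, the Neumann units `1 − [Ĝ′V̂(A′)]` (fine pieces, fine exact coefficients) and
`1 − [ĜV̂(Ā)]` (coarse pieces, exact coefficients READ FROM THE BLOCK MEAN) are invertible — the hypothesis `hunit` of M1 ∕ FILE 31, DISCHARGED in the window.  ★★★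
**`covLap_dressed_inverse_torus`**: in that window, the fine dressed propagator of `fgFamilyV1X` inverts `Δ_{e^{η′A′}} + (a·Q*Q − ∂P∂*)(1) ⊗ 1_𝔤` on BOTH sides and the coarse one inverts
`Δ_{e^{ηĀ}} + (a·Q*Q − ∂P∂*)(1) ⊗ 1_𝔤`, `Ā = gavgM pr_V A′` — the GENUINENESS CERTIFICATE of the operator layer: what `NE2PlusOperator c₃₅ (fgInstanceV1G …) (fgFamilyV1X …)` (FILE 30) is ABOUT
is the η-difference of the Green's functions of Bałaban's `Δ_a` (3.26) with its Laplacian made covariant at `U′ = e^{iηA′}` (gauge-fixing `DRD*` and averaging `aQ*Q` at `U ≡ 1`).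

HONEST FRAMING.  Bookkeeping over tree theorems (no new estimate); `U ≡ 1` chart with the unit-scale C² reading of (3.35)–(3.36); `𝔤 ↦ 𝔄`, coordinates `e`; block MEAN transport; `DRD*`,
`aQ*Q` NOT dressed; NE2⁺ NOT PRINTED, not claimed; count-neutral; N15 NOT discharged; one finite torus at fixed ε — NOT ℝ⁴, NOT infinite volume, NOT OS, NOT a mass gap, NOT Clay.
-/

noncomputable section

open scoped BigOperators
open Finset

namespace Summit.QuantumFields.YangMills.BalabanUVNodes.N15.BackgroundLayer

open Literature.MathematicalPhysics.QuantumFieldTheory.Balaban1983to89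
open Literature.MathematicalPhysics.QuantumFieldTheory.Balaban1983to89.B11SectG (BlockNorm HasMaj RowSum)
open Literature.MathematicalPhysics.QuantumFieldTheory.Balaban1983to89.T4EtaRateCoeffDefect (pull pull_apply diagK diagK_nonneg)
open Literature.MathematicalPhysics.QuantumFieldTheory.Balaban1983to89.B5Prop11Plancherel (Tor fine unitVec)
open Literature.MathematicalPhysics.QuantumFieldTheory.Balaban1983to89.B6UnitTorusCarrier (unitTorusGeo triangle254_unitTorusGeo rowSum_unitTorusGeo unitTorusGeo_dist_nonneg)
open Literature.MathematicalPhysics.QuantumFieldTheory.King1986.Torus (blockOf tdistT tdistT_nonneg tdistT_self)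
open Summit.QuantumFields.YangMills.BalabanUVNodes.N15.MatrixSpecies (mmulOp liftMap liftBlk liftEquiv basisConst basisConst_nonneg)
open Summit.QuantumFields.YangMills.BalabanUVNodes.N15.TwoGrid (gOp deltaOp symbOp sLap landauRe qvRe qvAdjRe TGIndex TGIndex.Mn)
open Summit.QuantumFields.YangMills.BalabanUVNodes.N15.VectorPiece (blkFine kingPrV bshiftEquiv tensorId)

variable (d : ℕ) {L : ℕ} [NeZero L] (𝔄 : Type) [NormedRing 𝔄] [NormedAlgebra ℝ 𝔄] [CompleteSpace 𝔄] (ι : Type) [Fintype ι] [DecidableEq ι] [Nonempty ι] (e : 𝔄 ≃L[ℝ] (ι → ℝ))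

/-- ★★ **THE NEUMANN INVERSES EXIST THROUGHOUT THE (3.35)-WINDOW** (fine pieces with the fine exact coefficients, coarse pieces with the exact coefficients of the block mean): M1's unit
hypothesis from the `U ≡ 1` layer's majorant `β·e^{−δd}` (FILE 27 §2), the coefficient rows `≤ κ′c₃₅Mα₀` (FILE 30 `twoSidedLettersX_torus`, clauses 1–4), n15-b `isUnit_stepV` with [B6]'s
row-sum constant at `σ = δ`, in the window `Mα₀ ≤ a₀`, `a₀ = min(r₀, (2βκ′(1+2(d+1))c_r)⁻¹)∕c₃₅`. [cite: Balaban1985BackgroundPropagators, (3.63)–(3.64) p.402 (mechanism); Balaban1984PropagatorsII, Lemma 2.1 (2.61) p.234] -/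
theorem isUnit_neumann_torus_window (hLodd : Odd L) (hL2 : 2 ≤ L) (hL : Odd L ∧ 1 < L) {b : ℝ} (hb : 0 < b) {c35 : ℝ} (hc35 : 0 < c35) :
    ∃ a₀ : ℝ, 0 < a₀ ∧ ∀ (i : TGIndex × Fin (d + 1)) (α₀ : ℝ), 0 < α₀ → (unitTorusGeo L i.1.k (TGIndex.Mn d hL i.1)).M * α₀ ≤ a₀ →
      ∀ A' : Fin (d + 1) → Tor (fine (L ^ i.1.m * L ^ i.1.k) (TGIndex.Mn d hL i.1)) × Fin (d + 1) → 𝔄,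
        (v1GaugeBg 𝔄 (Fin (d + 1)) (fun μ => bshiftEquiv (TGIndex.Mn d hL i.1) (L ^ i.1.m * L ^ i.1.k) μ)
            ((unitTorusGeo L i.1.k (TGIndex.Mn d hL i.1)).eta * ((unitTorusGeo L i.1.k (TGIndex.Mn d hL i.1)).L ^ i.1.m)⁻¹) (unitTorusGeo L i.1.k (TGIndex.Mn d hL i.1)).M).Reg335 c35 α₀ A' →
        IsUnit (1 - LinearMap.toMatrix' (stack (tensorId ι (gOp (TGIndex.Mn d hL i.1) (L ^ i.1.m * L ^ i.1.k) b)) (dPiecesM₂ d ι (TGIndex.Mn d hL i.1) (L ^ i.1.m * L ^ i.1.k) b) ∘ₗ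
          unstackM (v1cfgFX 𝔄 ι e (fun μ => bshiftEquiv (TGIndex.Mn d hL i.1) (L ^ i.1.m * L ^ i.1.k) μ)
              ((unitTorusGeo L i.1.k (TGIndex.Mn d hL i.1)).eta * ((unitTorusGeo L i.1.k (TGIndex.Mn d hL i.1)).L ^ i.1.m)⁻¹) A').1
            (v1cfgFX 𝔄 ι e (fun μ => bshiftEquiv (TGIndex.Mn d hL i.1) (L ^ i.1.m * L ^ i.1.k) μ)
              ((unitTorusGeo L i.1.k (TGIndex.Mn d hL i.1)).eta * ((unitTorusGeo L i.1.k (TGIndex.Mn d hL i.1)).L ^ i.1.m)⁻¹) A').2)) ∧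
        IsUnit (1 - LinearMap.toMatrix' (stack (tensorId ι (gOp (TGIndex.Mn d hL i.1) (L ^ i.1.k) b)) (dPiecesM₂ d ι (TGIndex.Mn d hL i.1) (L ^ i.1.k) b) ∘ₗ
          unstackM (v1cfgCX 𝔄 ι e (kingPrV L i.1.k i.1.m (TGIndex.Mn d hL i.1)) (fun μ => bshiftEquiv (TGIndex.Mn d hL i.1) (L ^ i.1.k) μ) (unitTorusGeo L i.1.k (TGIndex.Mn d hL i.1)).eta A').1
            (v1cfgCX 𝔄 ι e (kingPrV L i.1.k i.1.m (TGIndex.Mn d hL i.1)) (fun μ => bshiftEquiv (TGIndex.Mn d hL i.1) (L ^ i.1.k) μ) (unitTorusGeo L i.1.k (TGIndex.Mn d hL i.1)).eta A').2)) := by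
  have hγ0 : (0 : ℝ) < 1 / 16 := by norm_num
  obtain ⟨δ, β, m₀, cT, mT, hδ, -, hβ, -, -, -, -, H⟩ := uniform_layer_fullGM₂R d ι hLodd hL2 hL hb hγ0 le_rfl one_pos le_rfl
  have hγle1 : (1 : ℝ) / 16 ≤ 1 := by norm_num
  -- the letter scale and the window of FILE 30
  set κ' : ℝ := 14 * Real.exp 1 * (1 + Fintype.card (Fin (d + 1))) * ((1 + Fintype.card (Fin (d + 1))) * (3 + 2 * ((d : ℝ) + 1))) * (basisConst e + 1) with hκ'def
  set r₀ : ℝ := (2 * ((1 + Fintype.card (Fin (d + 1))) * (3 + 2 * ((d : ℝ) + 1))))⁻¹ with hr₀def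
  have hκe := basisConst_nonneg e
  have hdJ0 : (0 : ℝ) ≤ Fintype.card (Fin (d + 1)) := Nat.cast_nonneg _
  have hκ'pos : 0 < κ' := by positivity
  have hr₀ : 0 < r₀ := by positivity
  -- [B6]'s row-sum constant at `σ = δ` and the Neumann smallness window
  set cr : ℝ := B4Sect5Proof.latticeConst (d + 1) δ with hcrdef
  have hcr : 0 ≤ cr := B4Sect5Proof.latticeConst_nonneg (d + 1) hδ.le
  set NJ : ℝ := 1 + Fintype.card (Fin (d + 1) ⊕ Fin (d + 1)) with hNJ
  have hNJ0 : 0 < NJ := by positivity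
  set a₁ : ℝ := (2 * (β * κ' * NJ * cr + 1))⁻¹ with ha₁def
  have hden : 0 < 2 * (β * κ' * NJ * cr + 1) := by positivity
  have ha₁ : 0 < a₁ := inv_pos.2 hden
  refine ⟨min r₀ a₁ / c35, div_pos (lt_min hr₀ ha₁) hc35, fun i α₀ hα₀ hMa A' hreg => ?_⟩
  have hMeq : (unitTorusGeo L i.1.k (TGIndex.Mn d hL i.1)).M = 1 := rfl
  have hM : (1 : ℝ) ≤ (unitTorusGeo L i.1.k (TGIndex.Mn d hL i.1)).M := by rw [hMeq]
  have ha : c35 * (unitTorusGeo L i.1.k (TGIndex.Mn d hL i.1)).M * α₀ ≤ min r₀ a₁ := by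
    rw [mul_assoc]; exact (mul_le_mul_of_nonneg_left hMa hc35.le).trans (le_of_eq (mul_div_cancel₀ _ hc35.ne'))
  have hwin : c35 * (unitTorusGeo L i.1.k (TGIndex.Mn d hL i.1)).M * α₀ ≤ r₀ := ha.trans (min_le_left _ _)
  have hwin₁ : c35 * (unitTorusGeo L i.1.k (TGIndex.Mn d hL i.1)).M * α₀ ≤ a₁ := ha.trans (min_le_right _ _)
  have ha0 : 0 ≤ κ' * (c35 * (unitTorusGeo L i.1.k (TGIndex.Mn d hL i.1)).M * α₀) := by rw [hMeq]; positivity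
  obtain ⟨hC, hA, hC', hA', -⟩ := twoSidedLettersX_torus d 𝔄 ι e hL hL2 hγle1 hc35 i A' α₀ hreg hα₀ hM hwin
  -- smallness `β·R·c_r < 1`, `R = κ′c₃₅Mα₀·(1 + |J ⊕ J|)`
  have hq : β * (κ' * (c35 * (unitTorusGeo L i.1.k (TGIndex.Mn d hL i.1)).M * α₀) * NJ) * cr < 1 := by
    have h1 : β * (κ' * (c35 * (unitTorusGeo L i.1.k (TGIndex.Mn d hL i.1)).M * α₀) * NJ) * cr = (β * κ' * NJ * cr) * (c35 * (unitTorusGeo L i.1.k (TGIndex.Mn d hL i.1)).M * α₀) := by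
      ring
    rw [h1]
    have h2 : (β * κ' * NJ * cr) * (c35 * (unitTorusGeo L i.1.k (TGIndex.Mn d hL i.1)).M * α₀) ≤ (β * κ' * NJ * cr) * a₁ := mul_le_mul_of_nonneg_left hwin₁ (by positivity)
    refine lt_of_le_of_lt h2 ?_
    rw [ha₁def, ← div_eq_mul_inv, div_lt_one hden]
    nlinarith [mul_nonneg (mul_nonneg (mul_nonneg hβ.le hκ'pos.le) hNJ0.le) hcr]
  obtain ⟨hG, hD, hG', hD', -⟩ := H i
  have hd := fun a c : (unitTorusGeo L i.1.k (TGIndex.Mn d hL i.1)).Site => tdistT_nonneg (TGIndex.Mn d hL i.1) a c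
  have hrow := rowSum_unitTorusGeo L i.1.k (TGIndex.Mn d hL i.1) hδ
  have hK : ∀ y y' : (unitTorusGeo L i.1.k (TGIndex.Mn d hL i.1)).Site, 0 ≤ β * Real.exp (-(δ * (unitTorusGeo L i.1.k (TGIndex.Mn d hL i.1)).dist y y')) :=
    fun _ _ => mul_nonneg hβ.le (Real.exp_nonneg _)
  refine ⟨?_, ?_⟩
  · exact isUnit_stepV (liftBlk (blkFine L i.1.k (TGIndex.Mn d hL i.1) ∘ kingPrV L i.1.k i.1.m (TGIndex.Mn d hL i.1)) ι) (blkPair (liftBlk (blkFine L i.1.k (TGIndex.Mn d hL i.1) ∘ kingPrV L i.1.k i.1.m (TGIndex.Mn d hL i.1)) ι))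
      hd hrow le_rfl hβ.le (mul_nonneg ha0 hNJ0.le) (hasMaj_stack _ hK hG' hD') (hasMaj_unstackM _ ha0 hC' hA') hq
  · exact isUnit_stepV (liftBlk (blkFine L i.1.k (TGIndex.Mn d hL i.1)) ι) (blkPair (liftBlk (blkFine L i.1.k (TGIndex.Mn d hL i.1)) ι))
      hd hrow le_rfl hβ.le (mul_nonneg ha0 hNJ0.le) (hasMaj_stack _ hK hG hD) (hasMaj_unstackM _ ha0 hC hA) hq

/-- ★★★ **THE GENUINENESS CERTIFICATE OF THE OPERATOR LAYER, HYPOTHESIS-FREE IN THE (3.35)-WINDOW.**  There is `a₀ > 0` such that for every index `i` of the torus family of record, every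
`α₀ > 0` with `Mα₀ ≤ a₀` and every gauge field `A′` regular at `(c₃₅, α₀)` on the fine lattice (spacing `η′ = (L^mL^k)⁻¹`): the FINE dressed propagator of FILE 30's family (`gOp ⊗ 1_𝔤`,
`dPiecesM₂`, exact coefficients of `A′`) satisfies `[Δ_{e^{η′A′}} + (a·Q*Q − ∂P∂*)(1) ⊗ 1] ∘ X′ = 1 = X′ ∘ [⋯]`, and the COARSE one (spacing `η = (L^k)⁻¹`, exact coefficients of the block mean
`Ā = gavgM pr_V A′`) satisfies `[Δ_{e^{ηĀ}} + (a·Q*Q − ∂P∂*)(1) ⊗ 1] ∘ X = 1 = X ∘ [⋯]` — FILE 31 ★★★ at the units of `isUnit_neumann_torus_window`.  These `X′(A′)`, `X(Ā)` are, by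
definition (FILE 24 `bgOpsM₂R`, entry 0), the two operators whose η-difference `NE2PlusOperator c₃₅ (fgInstanceV1G …) (fgFamilyV1X …)` (FILE 30) estimates.
[cite: Balaban1985BackgroundPropagators, (3.26) p.395, (3.50)–(3.53) p.400, (3.62)–(3.65) p.402; Balaban1984PropagatorsI, (1.69)–(1.71) pp.29–30; King1986, p.664] -/
theorem covLap_dressed_inverse_torus (hLodd : Odd L) (hL2 : 2 ≤ L) (hL : Odd L ∧ 1 < L) {b : ℝ} (hb : 0 < b) {c35 : ℝ} (hc35 : 0 < c35) :
    ∃ a₀ : ℝ, 0 < a₀ ∧ ∀ (i : TGIndex × Fin (d + 1)) (α₀ : ℝ), 0 < α₀ → (unitTorusGeo L i.1.k (TGIndex.Mn d hL i.1)).M * α₀ ≤ a₀ →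
      ∀ A' : Fin (d + 1) → Tor (fine (L ^ i.1.m * L ^ i.1.k) (TGIndex.Mn d hL i.1)) × Fin (d + 1) → 𝔄,
        (v1GaugeBg 𝔄 (Fin (d + 1)) (fun μ => bshiftEquiv (TGIndex.Mn d hL i.1) (L ^ i.1.m * L ^ i.1.k) μ)
            ((unitTorusGeo L i.1.k (TGIndex.Mn d hL i.1)).eta * ((unitTorusGeo L i.1.k (TGIndex.Mn d hL i.1)).L ^ i.1.m)⁻¹) (unitTorusGeo L i.1.k (TGIndex.Mn d hL i.1)).M).Reg335 c35 α₀ A' →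
        ((covLapM (bshiftEquiv (TGIndex.Mn d hL i.1) (L ^ i.1.m * L ^ i.1.k)) (((L ^ i.1.m * L ^ i.1.k : ℕ) : ℝ)⁻¹)
              (gaugeTransport e (bshiftEquiv (TGIndex.Mn d hL i.1) (L ^ i.1.m * L ^ i.1.k)) (((L ^ i.1.m * L ^ i.1.k : ℕ) : ℝ)⁻¹) A') +
            tensorId ι (b • (qvAdjRe (TGIndex.Mn d hL i.1) (L ^ i.1.m * L ^ i.1.k) ∘ₗ qvRe (TGIndex.Mn d hL i.1) (L ^ i.1.m * L ^ i.1.k)) - landauRe (TGIndex.Mn d hL i.1) (L ^ i.1.m * L ^ i.1.k))) ∘ₗ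
            (projO none ∘ₗ bgPairM (tensorId ι (gOp (TGIndex.Mn d hL i.1) (L ^ i.1.m * L ^ i.1.k) b)) (dPiecesM₂ d ι (TGIndex.Mn d hL i.1) (L ^ i.1.m * L ^ i.1.k) b)
              (v1coefCX e ((((L ^ i.1.m * L ^ i.1.k : ℕ) : ℝ))⁻¹) (v1fieldsOfGauge 𝔄 (Fin (d + 1)) (bshiftEquiv (TGIndex.Mn d hL i.1) (L ^ i.1.m * L ^ i.1.k)) ((((L ^ i.1.m * L ^ i.1.k : ℕ) : ℝ))⁻¹) A'))
              (v1coefAX e ((((L ^ i.1.m * L ^ i.1.k : ℕ) : ℝ))⁻¹) (v1fieldsOfGauge 𝔄 (Fin (d + 1)) (bshiftEquiv (TGIndex.Mn d hL i.1) (L ^ i.1.m * L ^ i.1.k)) ((((L ^ i.1.m * L ^ i.1.k : ℕ) : ℝ))⁻¹) A'))) =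
            LinearMap.id ∧
          (projO none ∘ₗ bgPairM (tensorId ι (gOp (TGIndex.Mn d hL i.1) (L ^ i.1.m * L ^ i.1.k) b)) (dPiecesM₂ d ι (TGIndex.Mn d hL i.1) (L ^ i.1.m * L ^ i.1.k) b)
              (v1coefCX e ((((L ^ i.1.m * L ^ i.1.k : ℕ) : ℝ))⁻¹) (v1fieldsOfGauge 𝔄 (Fin (d + 1)) (bshiftEquiv (TGIndex.Mn d hL i.1) (L ^ i.1.m * L ^ i.1.k)) ((((L ^ i.1.m * L ^ i.1.k : ℕ) : ℝ))⁻¹) A'))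
              (v1coefAX e ((((L ^ i.1.m * L ^ i.1.k : ℕ) : ℝ))⁻¹) (v1fieldsOfGauge 𝔄 (Fin (d + 1)) (bshiftEquiv (TGIndex.Mn d hL i.1) (L ^ i.1.m * L ^ i.1.k)) ((((L ^ i.1.m * L ^ i.1.k : ℕ) : ℝ))⁻¹) A'))) ∘ₗ
            (covLapM (bshiftEquiv (TGIndex.Mn d hL i.1) (L ^ i.1.m * L ^ i.1.k)) (((L ^ i.1.m * L ^ i.1.k : ℕ) : ℝ)⁻¹)
              (gaugeTransport e (bshiftEquiv (TGIndex.Mn d hL i.1) (L ^ i.1.m * L ^ i.1.k)) (((L ^ i.1.m * L ^ i.1.k : ℕ) : ℝ)⁻¹) A') +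
            tensorId ι (b • (qvAdjRe (TGIndex.Mn d hL i.1) (L ^ i.1.m * L ^ i.1.k) ∘ₗ qvRe (TGIndex.Mn d hL i.1) (L ^ i.1.m * L ^ i.1.k)) - landauRe (TGIndex.Mn d hL i.1) (L ^ i.1.m * L ^ i.1.k))) =
            LinearMap.id) ∧
        ((covLapM (bshiftEquiv (TGIndex.Mn d hL i.1) (L ^ i.1.k)) (((L ^ i.1.k : ℕ) : ℝ)⁻¹)
              (gaugeTransport e (bshiftEquiv (TGIndex.Mn d hL i.1) (L ^ i.1.k)) (((L ^ i.1.k : ℕ) : ℝ)⁻¹) (gavgM 𝔄 (Fin (d + 1)) (kingPrV L i.1.k i.1.m (TGIndex.Mn d hL i.1)) A')) +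
            tensorId ι (b • (qvAdjRe (TGIndex.Mn d hL i.1) (L ^ i.1.k) ∘ₗ qvRe (TGIndex.Mn d hL i.1) (L ^ i.1.k)) - landauRe (TGIndex.Mn d hL i.1) (L ^ i.1.k))) ∘ₗ
            (projO none ∘ₗ bgPairM (tensorId ι (gOp (TGIndex.Mn d hL i.1) (L ^ i.1.k) b)) (dPiecesM₂ d ι (TGIndex.Mn d hL i.1) (L ^ i.1.k) b)
              (v1coefCX e ((((L ^ i.1.k : ℕ) : ℝ))⁻¹) (v1fieldsOfGauge 𝔄 (Fin (d + 1)) (bshiftEquiv (TGIndex.Mn d hL i.1) (L ^ i.1.k)) ((((L ^ i.1.k : ℕ) : ℝ))⁻¹)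
                (gavgM 𝔄 (Fin (d + 1)) (kingPrV L i.1.k i.1.m (TGIndex.Mn d hL i.1)) A')))
              (v1coefAX e ((((L ^ i.1.k : ℕ) : ℝ))⁻¹) (v1fieldsOfGauge 𝔄 (Fin (d + 1)) (bshiftEquiv (TGIndex.Mn d hL i.1) (L ^ i.1.k)) ((((L ^ i.1.k : ℕ) : ℝ))⁻¹)
                (gavgM 𝔄 (Fin (d + 1)) (kingPrV L i.1.k i.1.m (TGIndex.Mn d hL i.1)) A')))) = LinearMap.id ∧
          (projO none ∘ₗ bgPairM (tensorId ι (gOp (TGIndex.Mn d hL i.1) (L ^ i.1.k) b)) (dPiecesM₂ d ι (TGIndex.Mn d hL i.1) (L ^ i.1.k) b)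
              (v1coefCX e ((((L ^ i.1.k : ℕ) : ℝ))⁻¹) (v1fieldsOfGauge 𝔄 (Fin (d + 1)) (bshiftEquiv (TGIndex.Mn d hL i.1) (L ^ i.1.k)) ((((L ^ i.1.k : ℕ) : ℝ))⁻¹)
                (gavgM 𝔄 (Fin (d + 1)) (kingPrV L i.1.k i.1.m (TGIndex.Mn d hL i.1)) A')))
              (v1coefAX e ((((L ^ i.1.k : ℕ) : ℝ))⁻¹) (v1fieldsOfGauge 𝔄 (Fin (d + 1)) (bshiftEquiv (TGIndex.Mn d hL i.1) (L ^ i.1.k)) ((((L ^ i.1.k : ℕ) : ℝ))⁻¹)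
                (gavgM 𝔄 (Fin (d + 1)) (kingPrV L i.1.k i.1.m (TGIndex.Mn d hL i.1)) A')))) ∘ₗ
            (covLapM (bshiftEquiv (TGIndex.Mn d hL i.1) (L ^ i.1.k)) (((L ^ i.1.k : ℕ) : ℝ)⁻¹)
              (gaugeTransport e (bshiftEquiv (TGIndex.Mn d hL i.1) (L ^ i.1.k)) (((L ^ i.1.k : ℕ) : ℝ)⁻¹) (gavgM 𝔄 (Fin (d + 1)) (kingPrV L i.1.k i.1.m (TGIndex.Mn d hL i.1)) A')) +
            tensorId ι (b • (qvAdjRe (TGIndex.Mn d hL i.1) (L ^ i.1.k) ∘ₗ qvRe (TGIndex.Mn d hL i.1) (L ^ i.1.k)) - landauRe (TGIndex.Mn d hL i.1) (L ^ i.1.k))) =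
            LinearMap.id) := by
  obtain ⟨a₀, ha₀, H⟩ := isUnit_neumann_torus_window d 𝔄 ι e hLodd hL2 hL hb hc35
  refine ⟨a₀, ha₀, fun i α₀ hα₀ hMa A' hreg => ?_⟩
  obtain ⟨hUf, hUc⟩ := H i α₀ hα₀ hMa A' hreg
  have hL1 : 1 ≤ L := by omega
  have hLr : (0 : ℝ) < (L : ℝ) := by exact_mod_cast (show 0 < L by omega)
  have hηc : (unitTorusGeo L i.1.k (TGIndex.Mn d hL i.1)).eta = ((L : ℝ) ^ i.1.k)⁻¹ := rfl
  have hηf : (unitTorusGeo L i.1.k (TGIndex.Mn d hL i.1)).eta * ((unitTorusGeo L i.1.k (TGIndex.Mn d hL i.1)).L ^ i.1.m)⁻¹ = ((L : ℝ) ^ i.1.k)⁻¹ * ((L : ℝ) ^ i.1.m)⁻¹ := rfl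
  have hn : (unitTorusGeo L i.1.k (TGIndex.Mn d hL i.1)).eta = (((L ^ i.1.k : ℕ) : ℝ))⁻¹ := by rw [hηc]; push_cast; ring
  have hn' : (unitTorusGeo L i.1.k (TGIndex.Mn d hL i.1)).eta * ((unitTorusGeo L i.1.k (TGIndex.Mn d hL i.1)).L ^ i.1.m)⁻¹ = (((L ^ i.1.m * L ^ i.1.k : ℕ) : ℝ))⁻¹ := by
    rw [hηf, ← mul_inv]; push_cast; ring
  have hnf : 1 ≤ L ^ i.1.m * L ^ i.1.k := Nat.one_le_iff_ne_zero.mpr (by positivity)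
  have hnc : 1 ≤ L ^ i.1.k := Nat.one_le_pow _ _ (by omega)
  have hUf' := hUf
  have hUc' := hUc
  rw [hn'] at hUf'
  rw [hn] at hUc'
  simp only [v1cfgFX] at hUf'
  simp only [v1cfgCX] at hUc'
  exact ⟨covLap_dressed_inverse ι (TGIndex.Mn d hL i.1) (L ^ i.1.m * L ^ i.1.k) e hnf hb A' hUf',
    covLap_dressed_inverse ι (TGIndex.Mn d hL i.1) (L ^ i.1.k) e hnc hb (gavgM 𝔄 (Fin (d + 1)) (kingPrV L i.1.k i.1.m (TGIndex.Mn d hL i.1)) A') hUc'⟩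

end Summit.QuantumFields.YangMills.BalabanUVNodes.N15.BackgroundLayer

end
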